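import Summits.ResolutionOfSingularities.ResolutionOfSingularities.Theses.SyzygyFlattening

/-!
# `HigherRankTermination` (crux stmt-ResolutionOfSingularities-17045, route `SyzygyFlattening`):
# valuation rings are fixed points of the syzygy-flattening operator
# (negative-side support, refuter cdisprove seat; does NOT refute the crux)

The crux is `∀ p prime, R1_p → DZ_p` (termination of the route's tower along rank-one
dimension-zero valuations ⇒ along all dimension-zero valuations). This file records, sorry-free:

* `tower` — the route's tower `T₀ = A_c, T_{m+1} = (nrm (chart T_m))_c`, verbatim the `let`-block
  of `Theses/SyzygyFlattening.lean` (`higherRankTermination_iff` below is `Iff.rfl`, which CHECKS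
  that this is the route's term and ties the file to the Theses decl).
* `loc_self`, `adjoin_union_eq_self`, `adjoin_integral_eq_self`, `tower_valuationSubring` — **the valuation ring itself is a
  fixed point of the operator**: started at the (in general non-Noetherian) `k`-subalgebra `A = O`,
  every stage of the tower is `O` again (`loc O = O` trivially; `chart O = O` because every adjoined
  Plücker ratio is REQUIRED to lie in `O`; `nrm O = O` because valuation rings are integrally
  closed — `Valuation.Integers.mem_of_integral`). So the operator makes progress only through the
  finite generation of the models, never through the valuation.
* The consequence — the conclusion of the crux with the single binder `A.FG` deleted is FALSE at
  every prime, already on its off-rank-one part — is the companion file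
  `Negative/ConclusionFalseWithoutFG.lean` (rank-two Hahn valuation ring of `𝔽_p((t^{ℤ ×ₗ ℤ}))`).

Moral for provers: any proof of the crux must use `A.FG` in the conclusion's binders (through
excellence / finiteness of normalisation / Noetherianity of the stages); and for the disprover: the
route's kill criterion (a loop of the operator) cannot come from the valuation ring alone.
-/

noncomputable section

set_option linter.dupNamespace false

namespace Summit.ResolutionOfSingularities.ResolutionOfSingularities.Theorems.HigherRankTermination.Negative

open Summit.ResolutionOfSingularities.ResolutionOfSingularities.Theses.SyzygyFlattening
  (HigherRankTermination)

/-! ## The route's tower, verbatim -/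

/-- The syzygy-flattening tower along `O` from `A` — verbatim the `let`-bound
`n, J, loc, chart, nrm, tower` of every item of `Theses/SyzygyFlattening.lean`. -/
def tower (k K : Type) [Field k] [Field K] [Algebra k K] (O : ValuationSubring K)
    (A : Subalgebra k K) (m : ℕ) : Subalgebra k K :=
  let n : ℕ := Cardinal.toNat (Algebra.trdeg k K); let J : (B : Subalgebra k K) → Ideal ↥B := fun B => sInf ((fun 𝔭 : PrimeSpectrum ↥B => 𝔭.asIdeal) '' {𝔭 : PrimeSpectrum ↥B | ¬ IsRegularLocalRing (Localization.AtPrime 𝔭.asIdeal)}); let loc : Subalgebra k K → Subalgebra k K := fun B => Algebra.adjoin k {y : K | ∃ a ∈ B, ∃ s ∈ B, s⁻¹ ∈ O ∧ y = a * s⁻¹}; let chart : Subalgebra k K → Subalgebra k K := fun B => Algebra.adjoin k ((B : Set K) ∪ {y : K | ∃ (b : ℕ → ℕ) (d : (i : ℕ) → ((Fin (b (i + 1)) → ↥B) →ₗ[↥B] (Fin (b i) → ↥B))) (ε : (Fin (b 0) → ↥B) →ₗ[↥B] (↥B ⧸ J B)) (r : ℕ) (ι : ↥(LinearMap.range (d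 (n - 1))) →ₗ[↥B] (Fin r → ↥B)), Function.Surjective ε ∧ Function.Exact (d 0) ε ∧ (∀ i : ℕ, Function.Exact (d (i + 1)) (d i)) ∧ Function.Injective ι ∧ (∀ z : Fin r → ↥B, ∃ a : ↥B, a ≠ 0 ∧ a • z ∈ LinearMap.range ι) ∧ ∃ g x : Fin r → ↥(LinearMap.range (d (n - 1))), Matrix.det (Matrix.of fun i j => ((ι (x i) j : ↥B) : K)) ≠ 0 ∧ (∀ g' : Fin r → ↥(LinearMap.range (d (n - 1))), Matrix.det (Matrix.of fun i j => ((ι (g' i) j : ↥B) : K)) * (Matrix.det (Matrix.of fun i j => ((ι (x i) j : ↥B) : K)))⁻¹ ∈ O) ∧ y = Matrix.det (Matrix.of fun i j => ((ι (g i) j : ↥B) : K)) * (Matrix.det (Matrix.of fun i j => ((ι (x i) j : ↥B) : K)))⁻¹}); let nrm : Subalgebra k K → Subalgebra k K := fun B => Algebra.adjoin k {y : K | IsIntegral ↥B y}; let tower : Subalgebra k K → ℕ → Subalgebra k K := fun A m => @Nat.rec (fun _ => Subalgebra k K) (loc A) (fun _ B => loc (nrm (chart B))) m; tower A m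

section Operator

variable {k K : Type} [Field k] [Field K] [Algebra k K] (O : ValuationSubring K)

/-- The `loc` step of the route (localisation at the centre of `O`, inside `K`), by name. -/
def locO (B : Subalgebra k K) : Subalgebra k K :=
  Algebra.adjoin k {y : K | ∃ a ∈ B, ∃ s ∈ B, s⁻¹ ∈ O ∧ y = a * s⁻¹}

/-- The `nrm` step of the route (integral closure inside `K`), by name. -/
def nrmO (B : Subalgebra k K) : Subalgebra k K :=
  Algebra.adjoin k {y : K | IsIntegral ↥B y}

/-- The `chart` step of the route (adjoin the `O`-minimal Plücker ratios of the `n`-th syzygy module of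
`B / J B`), by name — the `let`-bound `n` and `J` inlined. -/
def chartO (B : Subalgebra k K) : Subalgebra k K :=
  Algebra.adjoin k ((B : Set K) ∪ {y : K | ∃ (b : ℕ → ℕ) (d : (i : ℕ) → ((Fin (b (i + 1)) → ↥B) →ₗ[↥B] (Fin (b i) → ↥B))) (ε : (Fin (b 0) → ↥B) →ₗ[↥B] (↥B ⧸ (sInf ((fun 𝔭 : PrimeSpectrum ↥B => 𝔭.asIdeal) '' {𝔭 : PrimeSpectrum ↥B | ¬ IsRegularLocalRing (Localization.AtPrime 𝔭.asIdeal)})))) (r : ℕ) (ι : ↥(LinearMap.range (d (Cardinal.toNat (Algebra.trdeg k K) - 1))) →ₗ[↥B] (Fin r → ↥B)), Function.Surjective ε ∧ Function.Exact (d 0) ε ∧ (∀ i : ℕ, Function.Exact (d (i + 1)) (d i)) ∧ Function.Injective ι ∧ (∀ z : Fin r → ↥B, ∃ a : ↥B, a ≠ 0 ∧ a • z ∈ LinearMap.range ι) ∧ ∃ g x : Fin r → ↥(LinearMap.range (d (Cardinal.toNat (Algebra.trdeg k K) - 1))), Matrix.det (Matrix.of fun i j => ((ι (x i) j : ↥B)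 : K)) ≠ 0 ∧ (∀ g' : Fin r → ↥(LinearMap.range (d (Cardinal.toNat (Algebra.trdeg k K) - 1))), Matrix.det (Matrix.of fun i j => ((ι (g' i) j : ↥B) : K)) * (Matrix.det (Matrix.of fun i j => ((ι (x i) j : ↥B) : K)))⁻¹ ∈ O) ∧ y = Matrix.det (Matrix.of fun i j => ((ι (g i) j : ↥B) : K)) * (Matrix.det (Matrix.of fun i j => ((ι (x i) j : ↥B) : K)))⁻¹})

variable (A : Subalgebra k K)

/-- Stage `0` of the tower is `loc A`. -/
theorem tower_zero : tower k K O A 0 = locO O A := rfl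

/-- Stage `m+1` of the tower is `loc (nrm (chart (stage m)))`. -/
theorem tower_succ (m : ℕ) : tower k K O A (m + 1) = locO O (nrmO (chartO O (tower k K O A m))) := rfl

end Operator


/-- Sanity (and the tie to the Theses decl): the crux is, on the nose, "termination of `tower` along
rank-one dimension-zero valuations ⇒ termination of `tower` along all dimension-zero valuations". -/
theorem higherRankTermination_iff :
    HigherRankTermination ↔ ∀ p : ℕ, p.Prime →
      (∀ (k K : Type) [Field k] [CharP k p] [Field K] [Algebra k K] (O : ValuationSubring K)
        (A : Subalgebra k K), (∀ c : k, algebraMap k K c ∈ O) → A.FG → IsFractionRing ↥A K →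
        A.toSubring ≤ O.toSubring →
        (∀ y : K, y ∈ O → ∃ f : Polynomial k, f ≠ 0 ∧ O.valuation (Polynomial.aeval y f) < 1) →
        ringKrullDim ↥O = 1 → ∃ m : ℕ, IsRegularLocalRing ↥(tower k K O A m)) →
      ∀ (k K : Type) [Field k] [CharP k p] [Field K] [Algebra k K] (O : ValuationSubring K)
        (A : Subalgebra k K), (∀ c : k, algebraMap k K c ∈ O) → A.FG → IsFractionRing ↥A K →
        A.toSubring ≤ O.toSubring →
        (∀ y : K, y ∈ O → ∃ f : Polynomial k, f ≠ 0 ∧ O.valuation (Polynomial.aeval y f) < 1) →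
        ∃ m : ℕ, IsRegularLocalRing ↥(tower k K O A m) :=
  Iff.rfl

/-! ## Valuation rings are fixed points of the operator -/

section FixedPoint

variable {k K : Type} [Field k] [Field K] [Algebra k K] (O : ValuationSubring K)
  (A : Subalgebra k K)

/-- `loc B = B` as soon as `B` contains the `O`-inverses of its `O`-units (e.g. `B = O`). -/
theorem loc_self (hinv : ∀ s ∈ A, s⁻¹ ∈ O → s⁻¹ ∈ A) :
    Algebra.adjoin k {y : K | ∃ a ∈ A, ∃ s ∈ A, s⁻¹ ∈ O ∧ y = a * s⁻¹} = A := by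
  refine le_antisymm (Algebra.adjoin_le ?_) ?_
  · rintro y ⟨a, ha, s, hs, hsO, rfl⟩
    exact A.mul_mem ha (hinv s hs hsO)
  · intro a ha
    refine Algebra.subset_adjoin ⟨a, ha, 1, A.one_mem, ?_, by simp⟩
    rw [inv_one]
    exact O.one_mem

/-- `chart B = B` as soon as `B ⊇ O`-valued ratios it adjoins — in particular for `B = O`: every
adjoined Plücker ratio `det g / det x` is, by the defining clause `∀ g', det g' / det x ∈ O`, in `O`. -/
theorem adjoin_union_eq_self {S : Set K} (hS : S ⊆ A) :
    Algebra.adjoin k ((A : Set K) ∪ S) = A := by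
  refine le_antisymm (Algebra.adjoin_le ?_) ?_
  · rintro y (hy | hy)
    · exact hy
    · exact hS hy
  · exact fun a ha => Algebra.subset_adjoin (Or.inl ha)

/-- `nrm B = B` for `B` integrally closed in `K` (e.g. a valuation ring). -/
theorem adjoin_integral_eq_self (hint : ∀ y : K, IsIntegral ↥A y → y ∈ A) :
    Algebra.adjoin k {y : K | IsIntegral ↥A y} = A := by
  refine le_antisymm (Algebra.adjoin_le fun y hy => hint y hy) ?_
  intro a ha
  exact Algebra.subset_adjoin (isIntegral_algebraMap (R := ↥A) (A := K) (x := ⟨a, ha⟩))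

/-- The `k`-subalgebra of `K` underlying a valuation subring `O ⊇ k`. -/
def valuationSubalgebra (hk : ∀ c : k, algebraMap k K c ∈ O) : Subalgebra k K :=
  { O.toSubring with
    algebraMap_mem' := hk }

/-- Membership in `valuationSubalgebra O hk` is membership in `O`. -/
@[simp] theorem mem_valuationSubalgebra (hk : ∀ c : k, algebraMap k K c ∈ O) (x : K) :
    x ∈ valuationSubalgebra O hk ↔ x ∈ O := Iff.rfl

/-- Elements of `K` integral over the valuation ring `O` lie in `O`. -/
theorem mem_of_isIntegral_valuationSubalgebra (hk : ∀ c : k, algebraMap k K c ∈ O) (y : K)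
    (hy : IsIntegral ↥(valuationSubalgebra O hk) y) : y ∈ O := by
  have hv : O.valuation.Integers ↥(valuationSubalgebra O hk) :=
    { hom_inj := Subtype.val_injective
      map_le_one := fun x => (O.valuation_le_one_iff _).mpr x.2
      exists_of_le_one := fun r hr => ⟨⟨r, (O.valuation_le_one_iff r).mp hr⟩, rfl⟩ }
  have := hv.mem_of_integral hy
  exact (O.valuation_le_one_iff y).mp this

/-- **Valuation rings are fixed points of the operator**: the route's tower along `O` started at
`A = O` (as a `k`-subalgebra) is constantly `O`. -/
theorem tower_valuationSubring (hk : ∀ c : k, algebraMap k K c ∈ O) (m : ℕ) :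
    tower k K O (valuationSubalgebra O hk) m = valuationSubalgebra O hk := by
  set A := valuationSubalgebra O hk with hA
  have hloc : locO O A = A := loc_self O A (fun s _ hsO => hsO)
  have hnrm : nrmO A = A := adjoin_integral_eq_self A (mem_of_isIntegral_valuationSubalgebra O hk)
  have hchart : chartO O A = A := by
    refine adjoin_union_eq_self A ?_
    -- every adjoined ratio is in `O = A` by its own defining clause (take `g' := g`)
    intro y hy
    obtain ⟨b, d, ε, r, ι, -, -, -, -, -, g, x, -, hO, rfl⟩ := hy
    exact hO g
  induction m with
  | zero => rw [tower_zero]; exact hloc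
  | succ m ih =>
    rw [tower_succ, ih, hchart]
    show locO O (nrmO A) = A
    rw [show nrmO A = A from hnrm]
    exact hloc

end FixedPoint

end Summit.ResolutionOfSingularities.ResolutionOfSingularities.Theorems.HigherRankTermination.Negative

end
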